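import Literature.NumberTheory.Weil1965.AdelicSiegelFibreMeasureSplitPlaceWeighted
import Literature.NumberTheory.Weil1965.AdelicSiegelFunctionalOfQuadraticMap
import HarnessLib

/-!
# The Eisenstein fibre measure of a RATIONAL QUADRATIC FORM at a split place — condition (B) discharged

Topic `NumberTheory/Weil1965`; namespace `Literature.NumberTheory.Weil1965`.  KERNEL mathematics only (theorems; no definition,
no named fact, no `axiom`, no `sorry`).  TRANSPORT file in the pattern of ★ `AdelicSiegelFunctionalOfQuadraticMap`: the heads of
★ `AdelicSiegelFibreMeasureSplitPlace` (rectangles) and ★ `AdelicSiegelFibreMeasureSplitPlaceWeighted` (weights, consumer shapes) for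
a map `h : 𝔸_F^m → 𝔸_F` that IS a rational quadratic form, `hhS : ∀ x, h x = q_S(x)` (`S` rational symmetric, `det S ≠ 0`, `4 < m`,
`F` totally real), with Weil's condition (B) — the `hB` slot of `adelicSiegelFibreMeasure F (Fin m) μ h hh hB b` — FILLED by the one
token `fun _ => summable_norm_adelicSiegelCoeff_of_eq_sdForm F μ hm hS hdet hhS` (★) ([Weil1965, Chap. IV n° 40 Thm 1]; ★
`summable_norm_adelicSiegelCoeff_sdForm`).  Any other proof of (B) gives the same measure definitionally (proof irrelevance), so a
consumer holding its own `hB` applies these heads with `exact`.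

Heads (all modulo the split-place chart letters `e, b, b', hfib, T, hTμ, hTh, hTS, hTe` of (BRIDGE-v) only):
* `map_adelicSiegelFibreMeasure_identityClose_hypotheses_of_eq_sdForm` — `hfin ∧ hinv ∧ hcar` in the I-CLOSE consumer's shapes;
* `exists_lintegral_mul_weight_map_adelicSiegelFibreMeasure_eq_mul_fibreMeasure_of_eq_sdForm` (+ `…_of_schwartzBruhat_of_eq_sdForm`)
  — `∫⁻ f(z) φ(y) d(e_* μ_b) = c(φ) · ∫⁻ f dμ_{b',v}`;
* `map_adelicSiegelFibreMeasure_prod_eq_mul_fibreMeasure_of_eq_sdForm` — `(e_* μ_b)(A × B) = c_B · μ_{b',v}(A)`.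

Cell `hodgecm-mathlib`, FLOOR 0, crux H413 (stmt-HodgeConjecture-24833), E-2 ∕ SW2 I-CLOSE sheet c78afe1b §1 (E-FAC), row (i) of
F0P4-plan (g4) 2026-08-31 04:09:06Z.  HC_CM is proved only modulo the 7 printed citations until rung 0 closes; this file is unconditional.

## References
* [Weil1965] A. Weil, *Sur la formule de Siegel dans la théorie des groupes classiques*, Acta Math. 113 (1965): Chap. IV n° 40
  Thm 1 p. 57, n° 41 (35) p. 59, n° 46 p. 66; Chap. V n° 49 Lemme 22 p. 70, n° 51 p. 73.
-/

set_option autoImplicit false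

noncomputable section

open MeasureTheory Filter Topology Set NumberField IsDedekindDomain
open scoped NNReal ENNReal Matrix Classical
open Literature.NumberTheory.Automorphic
open Literature.NumberTheory.Weil1964

namespace Literature.NumberTheory.Weil1965

variable (F : Type) [Field F] [NumberField F] [IsTotallyReal F] {m : ℕ}
  [MeasurableSpace (adeleQuotient F)] [BorelSpace (adeleQuotient F)]
  [MeasurableSpace (AdeleRing (𝓞 F) F)] [BorelSpace (AdeleRing (𝓞 F) F)]
  (μ : Measure (Fin m → AdeleRing (𝓞 F) F)) [μ.IsAddHaarMeasure] (hm : 4 < m)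
  {S : Matrix (Fin m) (Fin m) F} (hS : S.IsSymm) (hdet : S.det ≠ 0)
  {h : (Fin m → AdeleRing (𝓞 F) F) → AdeleRing (𝓞 F) F} (hhS : ∀ x, h x = sdForm F (ratMatrix F S) x) (hh : Continuous h)
  {K : Type*} [Field K] [ValuativeRel K] [TopologicalSpace K] [IsNonarchimedeanLocalField K]
  [MeasurableSpace K] [BorelSpace K] [MeasurableSingletonClass K] (μK : Measure K) [μK.IsAddHaarMeasure]
  {κ : Type*} [Fintype κ] [Nonempty κ] [DecidableEq κ] (hκ : 2 ≤ Fintype.card κ)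
  {Y : Type*} [TopologicalSpace Y] [T2Space Y] [MeasurableSpace Y] [BorelSpace Y] [SecondCountableTopology Y]
  (e : (Fin m → AdeleRing (𝓞 F) F) ≃ₜ ((κ → K) × (κ → K)) × Y)
  (b : F) (b' : K)
  (hfib : ∀ x, h x = algebraMap F (AdeleRing (𝓞 F) F) b →
    (e x).1.1 ⬝ᵥ (e x).1.2 = b' ∧ (e x).1.1 ≠ 0 ∧ (e x).1.2 ≠ 0)
  (T : GL κ K → ((Fin m → AdeleRing (𝓞 F) F) ≃ₜ (Fin m → AdeleRing (𝓞 F) F)))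
  (hTμ : ∀ g, MeasurePreserving (T g) μ μ) (hTh : ∀ g x, h (T g x) = h x)
  (hTS : ∀ g, ∀ Φ ∈ piSchwartzBruhat F (Fin m), Φ ∘ T g ∈ piSchwartzBruhat F (Fin m))
  (hTe : ∀ g x, e (T g x) =
    ((((g : Matrix κ κ K) *ᵥ (e x).1.1, ((g⁻¹ : GL κ K) : Matrix κ κ K)ᵀ *ᵥ (e x).1.2) : (κ → K) × (κ → K)), (e x).2))

omit [MeasurableSingletonClass K] [Nonempty κ] in
include hfib hTμ hTh hTS hTe in
/-- **the I-CLOSE inputs of the Eisenstein fibre measure of `q_S` at a split place, (B) discharged**: `e_* μ_b` is finite on compact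
rectangles, invariant on Borel rectangles under `(x, y) ↦ (g x, g⁻ᵀ y)`, and carried by `S_{b'} × Y`.
[cite: Weil1965, Chap. IV n° 40 Thm 1, p. 57; n° 46, p. 66; n° 41 (35), p. 59] -/
theorem map_adelicSiegelFibreMeasure_identityClose_hypotheses_of_eq_sdForm :
    (∀ (L : Set ((κ → K) × (κ → K))) (B : Set Y), IsCompact L → IsCompact B →
      ((adelicSiegelFibreMeasure F (Fin m) μ h hh (fun _ => summable_norm_adelicSiegelCoeff_of_eq_sdForm F μ hm hS hdet hhS) b).map e)
        (L ×ˢ B) < ⊤) ∧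
    (∀ (g : GL κ K) (A : Set ((κ → K) × (κ → K))) (B : Set Y), MeasurableSet A → MeasurableSet B →
      ((adelicSiegelFibreMeasure F (Fin m) μ h hh (fun _ => summable_norm_adelicSiegelCoeff_of_eq_sdForm F μ hm hS hdet hhS) b).map e)
        (((fun z => (((g : Matrix κ κ K) *ᵥ z.1, ((g⁻¹ : GL κ K) : Matrix κ κ K)ᵀ *ᵥ z.2) : (κ → K) × (κ → K))) ⁻¹' A) ×ˢ B) =
      ((adelicSiegelFibreMeasure F (Fin m) μ h hh (fun _ => summable_norm_adelicSiegelCoeff_of_eq_sdForm F μ hm hS hdet hhS) b).map e)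
        (A ×ˢ B)) ∧
    ((adelicSiegelFibreMeasure F (Fin m) μ h hh (fun _ => summable_norm_adelicSiegelCoeff_of_eq_sdForm F μ hm hS hdet hhS) b).map e)
        ({z : (κ → K) × (κ → K) | z.1 ⬝ᵥ z.2 = b' ∧ z.1 ≠ 0 ∧ z.2 ≠ 0}ᶜ ×ˢ (univ : Set Y)) = 0 :=
  map_adelicSiegelFibreMeasure_identityClose_hypotheses F (Fin m) μ h hh _ e b b' hfib T hTμ hTh hTS hTe

omit [T2Space Y] in
include hfib hTμ hTh hTS hTe in
/-- **weighted (E-FAC) for `q_S`, (B) discharged**: `∫⁻ f(z) φ(y) d(e_* μ_b)(z, y) = c(φ) · ∫⁻ f dμ_{b',v}` for every Borel weight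
`φ ≥ 0` on `Y` with `∫_{C × Y} φ d(e_* μ_b) < ∞` on compacts. [cite: Weil1965, Chap. V n° 49 Lemma 22, p. 70; n° 51, p. 73; Chap. IV n° 40 Thm 1, p. 57] -/
theorem exists_lintegral_mul_weight_map_adelicSiegelFibreMeasure_eq_mul_fibreMeasure_of_eq_sdForm (φ : Y → ℝ≥0∞)
    (hφm : Measurable φ)
    (hφ : ∀ C : Set ((κ → K) × (κ → K)), IsCompact C →
      ∫⁻ z in C ×ˢ (univ : Set Y), φ z.2
        ∂((adelicSiegelFibreMeasure F (Fin m) μ h hh (fun _ => summable_norm_adelicSiegelCoeff_of_eq_sdForm F μ hm hS hdet hhS) b).map e)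
        < ⊤) :
    ∃ c : ℝ≥0, ∀ f : (κ → K) × (κ → K) → ℝ≥0∞, Measurable f →
      ∫⁻ z, f z.1 * φ z.2
          ∂((adelicSiegelFibreMeasure F (Fin m) μ h hh (fun _ => summable_norm_adelicSiegelCoeff_of_eq_sdForm F μ hm hS hdet hhS) b).map e) =
        c * ∫⁻ z, f z ∂(SplitPlace.fibreMeasure μK hκ b') :=
  exists_lintegral_mul_weight_map_adelicSiegelFibreMeasure_eq_mul_fibreMeasure F (Fin m) μ h hh _ μK hκ e b b' hfib T hTμ hTh
    hTS hTe φ hφm hφ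

omit [T2Space Y] in
include hfib hTμ hTh hTS hTe in
/-- weighted (E-FAC) for `q_S`, (B) discharged, the finiteness hypothesis discharged by TEMPEREDNESS: weights dominated on each
`e⁻¹(C × Y)` by a nonnegative Schwartz–Bruhat function (the case `φ ∈ 𝒮_ℝ(Y)`, `φ ≥ 0`).
[cite: Weil1965, Chap. V n° 49 Lemma 22, p. 70; n° 51, p. 73; Chap. IV n° 40 Thm 1, p. 57] -/
theorem exists_lintegral_mul_weight_map_adelicSiegelFibreMeasure_eq_mul_fibreMeasure_of_schwartzBruhat_of_eq_sdForm
    (φ : Y → ℝ≥0∞) (hφm : Measurable φ)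
    (hdom : ∀ C : Set ((κ → K) × (κ → K)), IsCompact C → ∃ Ψ : piSchwartzBruhatReal F (Fin m),
      0 ≤ (Ψ : (Fin m → AdeleRing (𝓞 F) F) → ℝ) ∧
        ∀ x, (e x).1 ∈ C → φ (e x).2 ≤ ENNReal.ofReal ((Ψ : (Fin m → AdeleRing (𝓞 F) F) → ℝ) x)) :
    ∃ c : ℝ≥0, ∀ f : (κ → K) × (κ → K) → ℝ≥0∞, Measurable f →
      ∫⁻ z, f z.1 * φ z.2
          ∂((adelicSiegelFibreMeasure F (Fin m) μ h hh (fun _ => summable_norm_adelicSiegelCoeff_of_eq_sdForm F μ hm hS hdet hhS) b).map e) =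
        c * ∫⁻ z, f z ∂(SplitPlace.fibreMeasure μK hκ b') :=
  exists_lintegral_mul_weight_map_adelicSiegelFibreMeasure_eq_mul_fibreMeasure_of_schwartzBruhat F (Fin m) μ h hh _ μK hκ e b b'
    hfib T hTμ hTh hTS hTe φ hφm hdom

omit [T2Space Y] in
include hfib hTμ hTh hTS hTe in
/-- weighted (E-FAC) for `q_S`, (B) discharged, REAL (Bochner) form. [cite: Weil1965, Chap. V n° 49 Lemma 22, p. 70; n° 51, p. 73] -/
theorem exists_integral_mul_weight_map_adelicSiegelFibreMeasure_eq_mul_integral_fibreMeasure_of_eq_sdForm (φ : Y → ℝ)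
    (hφm : Measurable φ) (hφ0 : ∀ y, 0 ≤ φ y)
    (hφ : ∀ C : Set ((κ → K) × (κ → K)), IsCompact C →
      ∫⁻ z in C ×ˢ (univ : Set Y), ENNReal.ofReal (φ z.2)
        ∂((adelicSiegelFibreMeasure F (Fin m) μ h hh (fun _ => summable_norm_adelicSiegelCoeff_of_eq_sdForm F μ hm hS hdet hhS) b).map e)
        < ⊤) :
    ∃ c : ℝ≥0, ∀ f : (κ → K) × (κ → K) → ℝ, Measurable f → (∀ z, 0 ≤ f z) →
      ∫ z, f z.1 * φ z.2
          ∂((adelicSiegelFibreMeasure F (Fin m) μ h hh (fun _ => summable_norm_adelicSiegelCoeff_of_eq_sdForm F μ hm hS hdet hhS) b).map e) =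
        c * ∫ z, f z ∂(SplitPlace.fibreMeasure μK hκ b') :=
  exists_integral_mul_weight_map_adelicSiegelFibreMeasure_eq_mul_integral_fibreMeasure F (Fin m) μ h hh _ μK hκ e b b' hfib T
    hTμ hTh hTS hTe φ hφm hφ0 hφ

include hfib hTμ hTh hTS hTe in
/-- **(E-FAC) on rectangles for `q_S`, (B) discharged**: `(e_* μ_b)(A × B) = c_B · μ_{b',v}(A)` for Borel `A` and relatively compact
Borel `B ⊆ Y`. [cite: Weil1965, Chap. V n° 49 Lemma 22, p. 70; Chap. IV n° 44 Thm 2, p. 63; n° 40 Thm 1, p. 57] -/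
theorem map_adelicSiegelFibreMeasure_prod_eq_mul_fibreMeasure_of_eq_sdForm {B : Set Y} (hBm : MeasurableSet B)
    (hBc : IsCompact (closure B)) :
    ∃ c : ℝ≥0, ∀ A : Set ((κ → K) × (κ → K)), MeasurableSet A →
      ((adelicSiegelFibreMeasure F (Fin m) μ h hh (fun _ => summable_norm_adelicSiegelCoeff_of_eq_sdForm F μ hm hS hdet hhS) b).map e)
        (A ×ˢ B) = c * SplitPlace.fibreMeasure μK hκ b' A :=
  map_adelicSiegelFibreMeasure_prod_eq_mul_fibreMeasure F (Fin m) μ h hh _ μK hκ e b b' hfib T hTμ hTh hTS hTe hBm hBc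

end Literature.NumberTheory.Weil1965

end
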